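import Mathlib
import Summits.Ventures.PercRepro2.CoinKSureGate
import Summits.Ventures.PercRepro2.CoinKSureAD
import Summits.Ventures.PercRepro2.CoinChainAWorldLemmas

/-!
# The pure AND-switch chain with head-blind non-entries — the lifted law
(blind cell PercRepro2, night-2 g20; proofs/NIGHT2-DARC.md §60)

The pure chain pair on `U.powerset`: `R = ν · chainMix ∅ ent' ρ c d`, gate
`G = ν · chainMix ∅ ent' ρ c d'` (the `a'`-coin of probability `ρ`, entries `ent' ⊆ U` sure).
HYPOTHESIS OF THIS PROGRAMME: the head is BLIND to the non-entries — `c W = c (W ∩ ent')`,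
`d W = d (W ∩ ent')`, `d' W = d' (W ∩ ent')` (every vertex of `U ∖ ent'` has no route into the
head; in particular `ent' = U`, the covering chain, with ARBITRARY markers).

THIS FILE: the coin resolved as a virtual core vertex `x₀ ∉ U`.  On `(insert x₀ U).powerset`
the lifted law `liftLaw U ent' x₀ ρ ν c d e` is `ρ·ν W·e W` on `(W, on)` and `ν W·blindOff W` on
`(W, off)`, with `blindOff W = (1 − ρ)·c W` on the entered clusters and `c W − ρ·d W` on the
entry-free ones (the coin-closed mass PLUS the mass the coin would have killed — `a` is never
entered there); `e = d` gives the lifted `R`-law, `e = d'` the lifted gate.  This is an OR-tail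
pair with the single sure entry `x₀`: both laws are log-supermodular (`liftLaw_lsm`), the gate
is Holley-above the `R`-law from every cluster containing `x₀` (`liftLaw_cross`), and equal to
it off `x₀` (`liftLaw_off`).  BLINDNESS is exactly what makes the `off` part log-supermodular
(`blindOff_lsm`, `blindOff_cross`: the entry-free clusters all carry `c ∅ − ρ·d ∅`).
`blindOff_add` / `blindOff_add'`: summing the two lifted weights of a cluster returns the chain
`R`-value, resp. the chain gate value minus the entry-free pivotal mass `ρ·(d − d')`.
The theorem is assembled in `CoinChainBlind.lean`.
-/

namespace Summit.Ventures.PercRepro2.Coin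

open Classical

section ChainBlind

variable {V : Type*} [DecidableEq V] {R : Type*} [Field R] [LinearOrder R] [IsStrictOrderedRing R]

/-- The `off` weight of the lifted law: `(1 − ρ)·c` on the entered clusters, `c − ρ·d` on the
entry-free ones (the coin-closed mass plus the mass the coin would have killed). -/
def blindOff (ent' : Finset V) (ρ : R) (c d : Finset V → R) (W : Finset V) : R :=
  if ∃ r ∈ ent', r ∈ W then (1 - ρ) * c W else c W - ρ * d W

/-- A cluster missing every entry has empty entry trace. -/
lemma inter_ent_eq_empty_of_not {ent' W : Finset V} (h : ¬ ∃ r ∈ ent', r ∈ W) :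
    W ∩ ent' = ∅ := by
  rw [Finset.eq_empty_iff_forall_notMem]
  intro r hr
  rw [Finset.mem_inter] at hr
  exact h ⟨r, hr.2, hr.1⟩

/-- `blindOff` is nonnegative. -/
lemma blindOff_nonneg (ent' : Finset V) (ρ : R) (c d : Finset V → R) (hρ0 : 0 ≤ ρ) (hρ1 : ρ ≤ 1)
    (hc0 : ∀ W, 0 ≤ c W) (hd0 : ∀ W, 0 ≤ d W) (hdc : ∀ W, d W ≤ c W) (W : Finset V) :
    0 ≤ blindOff ent' ρ c d W := by
  unfold blindOff
  split_ifs
  · exact mul_nonneg (by linarith) (hc0 W)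
  · have h1 : ρ * d W ≤ ρ * c W := mul_le_mul_of_nonneg_left (hdc W) hρ0
    have h2 : 0 ≤ (1 - ρ) * c W := mul_nonneg (by linarith) (hc0 W)
    have h3 := hd0 W
    linarith

/-- `(1 − ρ)·c ≤ c − ρ·d`. -/
lemma one_sub_mul_le_sub (ρ : R) (cW dW : R) (hρ0 : 0 ≤ ρ) (hdc : dW ≤ cW) :
    (1 - ρ) * cW ≤ cW - ρ * dW := by
  have := mul_le_mul_of_nonneg_left hdc hρ0
  linarith

omit [LinearOrder R] [IsStrictOrderedRing R] in
/-- With blindness, `blindOff` on an entry-free cluster is `c ∅ − ρ·d ∅`. -/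
lemma blindOff_of_not (ent' : Finset V) (ρ : R) (c d : Finset V → R)
    (hbc : ∀ W, c W = c (W ∩ ent')) (hbd : ∀ W, d W = d (W ∩ ent'))
    {W : Finset V} (h : ¬ ∃ r ∈ ent', r ∈ W) :
    blindOff ent' ρ c d W = c ∅ - ρ * d ∅ := by
  unfold blindOff
  rw [if_neg h, hbc W, hbd W, inter_ent_eq_empty_of_not h]

omit [Field R] [LinearOrder R] [IsStrictOrderedRing R] in
/-- With blindness, the head values do not see an entry-free cluster joined on. -/
lemma blind_union_of_not (ent' : Finset V) (c : Finset V → R)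
    (hbc : ∀ W, c W = c (W ∩ ent')) {s t : Finset V} (hs : ¬ ∃ r ∈ ent', r ∈ s) :
    c (s ∪ t) = c t := by
  rw [hbc (s ∪ t), hbc t, Finset.union_inter_distrib_right, inter_ent_eq_empty_of_not hs,
    Finset.empty_union]

/-- The meet with an entry-free cluster is entry-free. -/
lemma not_meets_inter_left {ent' s t : Finset V} (hs : ¬ ∃ r ∈ ent', r ∈ s) :
    ¬ ∃ r ∈ ent', r ∈ s ∩ t := fun h => hs (meets_inter_left h)

/-- The meet with an entry-free cluster is entry-free. -/
lemma not_meets_inter_right {ent' s t : Finset V} (ht : ¬ ∃ r ∈ ent', r ∈ t) :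
    ¬ ∃ r ∈ ent', r ∈ s ∩ t := fun h => ht (meets_inter_right h)

/-- **`blindOff` is log-supermodular** (blindness is used on the entry-free side). -/
lemma blindOff_lsm (ent' : Finset V) (ρ : R) (c d : Finset V → R) (hρ0 : 0 ≤ ρ) (hρ1 : ρ ≤ 1)
    (hc0 : ∀ W, 0 ≤ c W) (hdc : ∀ W, d W ≤ c W)
    (hcc : ∀ s t, c s * c t ≤ c (s ∩ t) * c (s ∪ t))
    (hbc : ∀ W, c W = c (W ∩ ent')) (hbd : ∀ W, d W = d (W ∩ ent')) (s t : Finset V) :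
    blindOff ent' ρ c d s * blindOff ent' ρ c d t ≤
      blindOff ent' ρ c d (s ∩ t) * blindOff ent' ρ c d (s ∪ t) := by
  have h1ρ : 0 ≤ 1 - ρ := by linarith
  by_cases hs : ∃ r ∈ ent', r ∈ s <;> by_cases ht : ∃ r ∈ ent', r ∈ t
  · -- both entered
    have hu : ∃ r ∈ ent', r ∈ s ∪ t := meets_union_iff.2 (Or.inl hs)
    by_cases hi : ∃ r ∈ ent', r ∈ s ∩ t
    · unfold blindOff
      rw [if_pos hs, if_pos ht, if_pos hi, if_pos hu]
      have := hcc s t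
      calc (1 - ρ) * c s * ((1 - ρ) * c t) = (1 - ρ) * (1 - ρ) * (c s * c t) := by ring
        _ ≤ (1 - ρ) * (1 - ρ) * (c (s ∩ t) * c (s ∪ t)) :=
            mul_le_mul_of_nonneg_left this (mul_nonneg h1ρ h1ρ)
        _ = (1 - ρ) * c (s ∩ t) * ((1 - ρ) * c (s ∪ t)) := by ring
    · unfold blindOff
      rw [if_pos hs, if_pos ht, if_neg hi, if_pos hu]
      have h1 := hcc s t
      have h2 := one_sub_mul_le_sub ρ (c (s ∩ t)) (d (s ∩ t)) hρ0 (hdc _)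
      have h3 : 0 ≤ (1 - ρ) * c (s ∪ t) := mul_nonneg h1ρ (hc0 _)
      calc (1 - ρ) * c s * ((1 - ρ) * c t) = (1 - ρ) * (1 - ρ) * (c s * c t) := by ring
        _ ≤ (1 - ρ) * (1 - ρ) * (c (s ∩ t) * c (s ∪ t)) :=
            mul_le_mul_of_nonneg_left h1 (mul_nonneg h1ρ h1ρ)
        _ = ((1 - ρ) * c (s ∩ t)) * ((1 - ρ) * c (s ∪ t)) := by ring
        _ ≤ (c (s ∩ t) - ρ * d (s ∩ t)) * ((1 - ρ) * c (s ∪ t)) :=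
            mul_le_mul_of_nonneg_right h2 h3
  · -- `s` entered, `t` entry-free: equality by blindness
    have hi : ¬ ∃ r ∈ ent', r ∈ s ∩ t := not_meets_inter_right ht
    have hu : ∃ r ∈ ent', r ∈ s ∪ t := meets_union_iff.2 (Or.inl hs)
    have e1 := blindOff_of_not ent' ρ c d hbc hbd ht
    have e2 := blindOff_of_not ent' ρ c d hbc hbd hi
    have e3 : c (s ∪ t) = c s := by
      rw [Finset.union_comm]; exact blind_union_of_not ent' c hbc ht
    unfold blindOff at e1 e2 ⊢
    rw [if_pos hs, if_pos hu, e3, e1, e2]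
    ring_nf
    exact le_rfl
  · -- `s` entry-free, `t` entered: equality by blindness
    have hi : ¬ ∃ r ∈ ent', r ∈ s ∩ t := not_meets_inter_left hs
    have hu : ∃ r ∈ ent', r ∈ s ∪ t := meets_union_iff.2 (Or.inr ht)
    have e1 := blindOff_of_not ent' ρ c d hbc hbd hs
    have e2 := blindOff_of_not ent' ρ c d hbc hbd hi
    have e3 : c (s ∪ t) = c t := blind_union_of_not ent' c hbc hs
    unfold blindOff at e1 e2 ⊢
    rw [if_pos ht, if_pos hu, e3, e1, e2]
  · -- both entry-free: all four values equal
    have hi : ¬ ∃ r ∈ ent', r ∈ s ∩ t := not_meets_inter_left hs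
    have hu : ¬ ∃ r ∈ ent', r ∈ s ∪ t := fun h => by
      rcases meets_union_iff.1 h with h' | h'
      · exact hs h'
      · exact ht h'
    rw [blindOff_of_not ent' ρ c d hbc hbd hs, blindOff_of_not ent' ρ c d hbc hbd ht,
      blindOff_of_not ent' ρ c d hbc hbd hi, blindOff_of_not ent' ρ c d hbc hbd hu]

/-- **The cross inequality** `e s · blindOff t ≤ blindOff (s ∩ t) · e (s ∪ t)` for a head value
`e` jointly log-supermodular with `c` and blind (`e = d` or `e = d'`). -/
lemma blindOff_cross (ent' : Finset V) (ρ : R) (c d e : Finset V → R) (hρ0 : 0 ≤ ρ) (hρ1 : ρ ≤ 1)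
    (he0 : ∀ W, 0 ≤ e W) (hdc : ∀ W, d W ≤ c W)
    (hce : ∀ s t, c s * e t ≤ c (s ∩ t) * e (s ∪ t))
    (hbc : ∀ W, c W = c (W ∩ ent')) (hbd : ∀ W, d W = d (W ∩ ent'))
    (hbe : ∀ W, e W = e (W ∩ ent')) (s t : Finset V) :
    e s * blindOff ent' ρ c d t ≤ blindOff ent' ρ c d (s ∩ t) * e (s ∪ t) := by
  have h1ρ : 0 ≤ 1 - ρ := by linarith
  by_cases ht : ∃ r ∈ ent', r ∈ t
  · have h0 : c t * e s ≤ c (s ∩ t) * e (s ∪ t) := by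
      have := hce t s
      rwa [Finset.inter_comm, Finset.union_comm] at this
    by_cases hi : ∃ r ∈ ent', r ∈ s ∩ t
    · unfold blindOff
      rw [if_pos ht, if_pos hi]
      calc e s * ((1 - ρ) * c t) = (1 - ρ) * (c t * e s) := by ring
        _ ≤ (1 - ρ) * (c (s ∩ t) * e (s ∪ t)) := mul_le_mul_of_nonneg_left h0 h1ρ
        _ = (1 - ρ) * c (s ∩ t) * e (s ∪ t) := by ring
    · unfold blindOff
      rw [if_pos ht, if_neg hi]
      have h2 := one_sub_mul_le_sub ρ (c (s ∩ t)) (d (s ∩ t)) hρ0 (hdc _)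
      calc e s * ((1 - ρ) * c t) = (1 - ρ) * (c t * e s) := by ring
        _ ≤ (1 - ρ) * (c (s ∩ t) * e (s ∪ t)) := mul_le_mul_of_nonneg_left h0 h1ρ
        _ = ((1 - ρ) * c (s ∩ t)) * e (s ∪ t) := by ring
        _ ≤ (c (s ∩ t) - ρ * d (s ∩ t)) * e (s ∪ t) := mul_le_mul_of_nonneg_right h2 (he0 _)
  · have hi : ¬ ∃ r ∈ ent', r ∈ s ∩ t := not_meets_inter_right ht
    have e3 : e (s ∪ t) = e s := by
      rw [Finset.union_comm]; exact blind_union_of_not ent' e hbe ht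
    rw [blindOff_of_not ent' ρ c d hbc hbd ht, blindOff_of_not ent' ρ c d hbc hbd hi, e3]
    ring_nf
    exact le_rfl

omit [LinearOrder R] [IsStrictOrderedRing R] in
/-- Summing the two lifted `R`-weights of a cluster gives the chain `R`-value. -/
lemma blindOff_add (ent' : Finset V) (ρ : R) (c d : Finset V → R) (W : Finset V) :
    blindOff ent' ρ c d W + ρ * d W = chainMix ∅ ent' ρ c d W := by
  unfold blindOff chainMix
  rw [chainTheta_empty]
  split_ifs <;> ring

omit [LinearOrder R] [IsStrictOrderedRing R] in
/-- Summing the two lifted gate weights gives the chain gate value minus the entry-free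
pivotal mass `ρ·(d − d')`. -/
lemma blindOff_add' (ent' : Finset V) (ρ : R) (c d d' : Finset V → R) (W : Finset V) :
    blindOff ent' ρ c d W + ρ * d' W =
      chainMix ∅ ent' ρ c d' W -
        (if ∃ r ∈ ent', r ∈ W then (0 : R) else 1) * (ρ * (d W - d' W)) := by
  unfold blindOff chainMix
  rw [chainTheta_empty]
  split_ifs <;> ring


/-- The lifted law on `insert x₀ U` with head value `e` in the `on` part (`e = d`: the `R`-law;
`e = d'`: the gate): `ρ·ν·e` with the coin on, `ν·blindOff` with it off. -/
def liftLaw (U ent' : Finset V) (x₀ : V) (ρ : R) (ν c d e : Finset V → R) (W' : Finset V) : R :=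
  ν (W' ∩ U) * (if x₀ ∈ W' then ρ * e (W' ∩ U) else blindOff ent' ρ c d (W' ∩ U))

/-- The lifted law is nonnegative. -/
lemma liftLaw_nonneg (U ent' : Finset V) (x₀ : V) (ρ : R) (ν c d e : Finset V → R)
    (hρ0 : 0 ≤ ρ) (hρ1 : ρ ≤ 1) (hν0 : ∀ W, 0 ≤ ν W) (hc0 : ∀ W, 0 ≤ c W) (hd0 : ∀ W, 0 ≤ d W)
    (he0 : ∀ W, 0 ≤ e W) (hdc : ∀ W, d W ≤ c W) (W' : Finset V) :
    0 ≤ liftLaw U ent' x₀ ρ ν c d e W' := by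
  unfold liftLaw
  refine mul_nonneg (hν0 _) ?_
  split_ifs
  · exact mul_nonneg hρ0 (he0 _)
  · exact blindOff_nonneg ent' ρ c d hρ0 hρ1 hc0 hd0 hdc _

/-- The `on`/`off` factor of the lifted law is nonnegative. -/
lemma liftFactor_nonneg (U ent' : Finset V) (x₀ : V) (ρ : R) (c d e : Finset V → R)
    (hρ0 : 0 ≤ ρ) (hρ1 : ρ ≤ 1) (hc0 : ∀ W, 0 ≤ c W) (hd0 : ∀ W, 0 ≤ d W)
    (he0 : ∀ W, 0 ≤ e W) (hdc : ∀ W, d W ≤ c W) (W' : Finset V) :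
    0 ≤ (if x₀ ∈ W' then ρ * e (W' ∩ U) else blindOff ent' ρ c d (W' ∩ U)) := by
  split_ifs
  · exact mul_nonneg hρ0 (he0 _)
  · exact blindOff_nonneg ent' ρ c d hρ0 hρ1 hc0 hd0 hdc _

/-- **The lifted law is log-supermodular** on `insert x₀ U` (indeed on every pair of clusters
whose `U`-parts are in `U.powerset`): `ν` lsm, the `on` part `e` lsm, the cross inequality
`blindOff_cross` between `on` and `off`, and `blindOff_lsm` between `off` and `off`. -/
lemma liftLaw_lsm (U ent' : Finset V) (x₀ : V) (ρ : R) (ν c d e : Finset V → R)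
    (hρ0 : 0 ≤ ρ) (hρ1 : ρ ≤ 1) (hν0 : ∀ W, 0 ≤ ν W)
    (hν : ∀ s ⊆ U, ∀ t ⊆ U, ν s * ν t ≤ ν (s ∩ t) * ν (s ∪ t))
    (hc0 : ∀ W, 0 ≤ c W) (hd0 : ∀ W, 0 ≤ d W) (he0 : ∀ W, 0 ≤ e W) (hdc : ∀ W, d W ≤ c W)
    (hcc : ∀ s t, c s * c t ≤ c (s ∩ t) * c (s ∪ t))
    (hee : ∀ s t, e s * e t ≤ e (s ∩ t) * e (s ∪ t))
    (hce : ∀ s t, c s * e t ≤ c (s ∩ t) * e (s ∪ t))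
    (hbc : ∀ W, c W = c (W ∩ ent')) (hbd : ∀ W, d W = d (W ∩ ent'))
    (hbe : ∀ W, e W = e (W ∩ ent')) (s t : Finset V) :
    liftLaw U ent' x₀ ρ ν c d e s * liftLaw U ent' x₀ ρ ν c d e t ≤
      liftLaw U ent' x₀ ρ ν c d e (s ∩ t) * liftLaw U ent' x₀ ρ ν c d e (s ∪ t) := by
  have hI : (s ∩ t) ∩ U = (s ∩ U) ∩ (t ∩ U) := state_inter s t U
  have hU : (s ∪ t) ∩ U = (s ∩ U) ∪ (t ∩ U) := state_union s t U
  have hν' : ν (s ∩ U) * ν (t ∩ U) ≤ ν ((s ∩ t) ∩ U) * ν ((s ∪ t) ∩ U) := by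
    rw [hI, hU]
    exact hν (s ∩ U) Finset.inter_subset_right (t ∩ U) Finset.inter_subset_right
  have hf : (if x₀ ∈ s then ρ * e (s ∩ U) else blindOff ent' ρ c d (s ∩ U)) *
      (if x₀ ∈ t then ρ * e (t ∩ U) else blindOff ent' ρ c d (t ∩ U)) ≤
      (if x₀ ∈ s ∩ t then ρ * e ((s ∩ t) ∩ U) else blindOff ent' ρ c d ((s ∩ t) ∩ U)) *
      (if x₀ ∈ s ∪ t then ρ * e ((s ∪ t) ∩ U) else blindOff ent' ρ c d ((s ∪ t) ∩ U)) := by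
    rw [hI, hU]
    by_cases hs : x₀ ∈ s <;> by_cases ht : x₀ ∈ t
    · rw [if_pos hs, if_pos ht, if_pos (Finset.mem_inter.2 ⟨hs, ht⟩),
        if_pos (Finset.mem_union_left _ hs)]
      have := hee (s ∩ U) (t ∩ U)
      calc ρ * e (s ∩ U) * (ρ * e (t ∩ U)) = (ρ * ρ) * (e (s ∩ U) * e (t ∩ U)) := by ring
        _ ≤ (ρ * ρ) * (e (s ∩ U ∩ (t ∩ U)) * e (s ∩ U ∪ t ∩ U)) :=
            mul_le_mul_of_nonneg_left this (mul_nonneg hρ0 hρ0)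
        _ = ρ * e (s ∩ U ∩ (t ∩ U)) * (ρ * e (s ∩ U ∪ t ∩ U)) := by ring
    · rw [if_pos hs, if_neg ht, if_neg (fun h => ht (Finset.mem_inter.1 h).2),
        if_pos (Finset.mem_union_left _ hs)]
      have := blindOff_cross ent' ρ c d e hρ0 hρ1 he0 hdc hce hbc hbd hbe (s ∩ U) (t ∩ U)
      calc ρ * e (s ∩ U) * blindOff ent' ρ c d (t ∩ U)
          = ρ * (e (s ∩ U) * blindOff ent' ρ c d (t ∩ U)) := by ring
        _ ≤ ρ * (blindOff ent' ρ c d (s ∩ U ∩ (t ∩ U)) * e (s ∩ U ∪ t ∩ U)) :=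
            mul_le_mul_of_nonneg_left this hρ0
        _ = blindOff ent' ρ c d (s ∩ U ∩ (t ∩ U)) * (ρ * e (s ∩ U ∪ t ∩ U)) := by ring
    · rw [if_neg hs, if_pos ht, if_neg (fun h => hs (Finset.mem_inter.1 h).1),
        if_pos (Finset.mem_union_right _ ht)]
      have := blindOff_cross ent' ρ c d e hρ0 hρ1 he0 hdc hce hbc hbd hbe (t ∩ U) (s ∩ U)
      rw [Finset.inter_comm (t ∩ U), Finset.union_comm (t ∩ U)] at this
      calc blindOff ent' ρ c d (s ∩ U) * (ρ * e (t ∩ U))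
          = ρ * (e (t ∩ U) * blindOff ent' ρ c d (s ∩ U)) := by ring
        _ ≤ ρ * (blindOff ent' ρ c d (s ∩ U ∩ (t ∩ U)) * e (s ∩ U ∪ t ∩ U)) :=
            mul_le_mul_of_nonneg_left this hρ0
        _ = blindOff ent' ρ c d (s ∩ U ∩ (t ∩ U)) * (ρ * e (s ∩ U ∪ t ∩ U)) := by ring
    · rw [if_neg hs, if_neg ht, if_neg (fun h => hs (Finset.mem_inter.1 h).1),
        if_neg (fun h => by rcases Finset.mem_union.1 h with h | h; exact hs h; exact ht h)]
      exact blindOff_lsm ent' ρ c d hρ0 hρ1 hc0 hdc hcc hbc hbd (s ∩ U) (t ∩ U)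
  unfold liftLaw
  calc ν (s ∩ U) * (if x₀ ∈ s then ρ * e (s ∩ U) else blindOff ent' ρ c d (s ∩ U)) *
        (ν (t ∩ U) * (if x₀ ∈ t then ρ * e (t ∩ U) else blindOff ent' ρ c d (t ∩ U)))
      = (ν (s ∩ U) * ν (t ∩ U)) *
          ((if x₀ ∈ s then ρ * e (s ∩ U) else blindOff ent' ρ c d (s ∩ U)) *
           (if x₀ ∈ t then ρ * e (t ∩ U) else blindOff ent' ρ c d (t ∩ U))) := by ring
    _ ≤ (ν ((s ∩ t) ∩ U) * ν ((s ∪ t) ∩ U)) *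
          ((if x₀ ∈ s ∩ t then ρ * e ((s ∩ t) ∩ U) else blindOff ent' ρ c d ((s ∩ t) ∩ U)) *
           (if x₀ ∈ s ∪ t then ρ * e ((s ∪ t) ∩ U) else blindOff ent' ρ c d ((s ∪ t) ∩ U))) :=
        mul_le_mul hν' hf
          (mul_nonneg (liftFactor_nonneg U ent' x₀ ρ c d e hρ0 hρ1 hc0 hd0 he0 hdc s)
            (liftFactor_nonneg U ent' x₀ ρ c d e hρ0 hρ1 hc0 hd0 he0 hdc t))
          (mul_nonneg (hν0 _) (hν0 _))
    _ = _ := by ring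

/-- **The lifted gate is Holley-above the lifted `R`-law from every cluster containing `x₀`**:
`liftG s · liftR t ≤ liftR (s ∩ t) · liftG (s ∪ t)` for `x₀ ∈ s`. -/
lemma liftLaw_cross (U ent' : Finset V) (x₀ : V) (ρ : R) (ν c d d' : Finset V → R)
    (hρ0 : 0 ≤ ρ) (hρ1 : ρ ≤ 1) (hν0 : ∀ W, 0 ≤ ν W)
    (hν : ∀ s ⊆ U, ∀ t ⊆ U, ν s * ν t ≤ ν (s ∩ t) * ν (s ∪ t))
    (hc0 : ∀ W, 0 ≤ c W) (hd0 : ∀ W, 0 ≤ d W) (hd'0 : ∀ W, 0 ≤ d' W) (hdc : ∀ W, d W ≤ c W)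
    (hdd' : ∀ s t, d s * d' t ≤ d (s ∩ t) * d' (s ∪ t))
    (hcd' : ∀ s t, c s * d' t ≤ c (s ∩ t) * d' (s ∪ t))
    (hbc : ∀ W, c W = c (W ∩ ent')) (hbd : ∀ W, d W = d (W ∩ ent'))
    (hbd' : ∀ W, d' W = d' (W ∩ ent')) (s t : Finset V) (hs : x₀ ∈ s) :
    liftLaw U ent' x₀ ρ ν c d d' s * liftLaw U ent' x₀ ρ ν c d d t ≤
      liftLaw U ent' x₀ ρ ν c d d (s ∩ t) * liftLaw U ent' x₀ ρ ν c d d' (s ∪ t) := by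
  have hI : (s ∩ t) ∩ U = (s ∩ U) ∩ (t ∩ U) := state_inter s t U
  have hU : (s ∪ t) ∩ U = (s ∩ U) ∪ (t ∩ U) := state_union s t U
  have hν' : ν (s ∩ U) * ν (t ∩ U) ≤ ν ((s ∩ t) ∩ U) * ν ((s ∪ t) ∩ U) := by
    rw [hI, hU]
    exact hν (s ∩ U) Finset.inter_subset_right (t ∩ U) Finset.inter_subset_right
  have hf : (ρ * d' (s ∩ U)) *
      (if x₀ ∈ t then ρ * d (t ∩ U) else blindOff ent' ρ c d (t ∩ U)) ≤
      (if x₀ ∈ s ∩ t then ρ * d ((s ∩ t) ∩ U) else blindOff ent' ρ c d ((s ∩ t) ∩ U)) *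
      (ρ * d' ((s ∪ t) ∩ U)) := by
    rw [hI, hU]
    by_cases ht : x₀ ∈ t
    · rw [if_pos ht, if_pos (Finset.mem_inter.2 ⟨hs, ht⟩)]
      have := hdd' (t ∩ U) (s ∩ U)
      rw [Finset.inter_comm (t ∩ U), Finset.union_comm (t ∩ U)] at this
      calc ρ * d' (s ∩ U) * (ρ * d (t ∩ U)) = (ρ * ρ) * (d (t ∩ U) * d' (s ∩ U)) := by ring
        _ ≤ (ρ * ρ) * (d (s ∩ U ∩ (t ∩ U)) * d' (s ∩ U ∪ t ∩ U)) :=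
            mul_le_mul_of_nonneg_left this (mul_nonneg hρ0 hρ0)
        _ = ρ * d (s ∩ U ∩ (t ∩ U)) * (ρ * d' (s ∩ U ∪ t ∩ U)) := by ring
    · rw [if_neg ht, if_neg (fun h => ht (Finset.mem_inter.1 h).2)]
      have := blindOff_cross ent' ρ c d d' hρ0 hρ1 hd'0 hdc hcd' hbc hbd hbd' (s ∩ U) (t ∩ U)
      calc ρ * d' (s ∩ U) * blindOff ent' ρ c d (t ∩ U)
          = ρ * (d' (s ∩ U) * blindOff ent' ρ c d (t ∩ U)) := by ring
        _ ≤ ρ * (blindOff ent' ρ c d (s ∩ U ∩ (t ∩ U)) * d' (s ∩ U ∪ t ∩ U)) :=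
            mul_le_mul_of_nonneg_left this hρ0
        _ = blindOff ent' ρ c d (s ∩ U ∩ (t ∩ U)) * (ρ * d' (s ∩ U ∪ t ∩ U)) := by ring
  unfold liftLaw
  rw [if_pos hs, if_pos (Finset.mem_union_left _ hs)]
  calc ν (s ∩ U) * (ρ * d' (s ∩ U)) *
        (ν (t ∩ U) * (if x₀ ∈ t then ρ * d (t ∩ U) else blindOff ent' ρ c d (t ∩ U)))
      = (ν (s ∩ U) * ν (t ∩ U)) * ((ρ * d' (s ∩ U)) *
          (if x₀ ∈ t then ρ * d (t ∩ U) else blindOff ent' ρ c d (t ∩ U))) := by ring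
    _ ≤ (ν ((s ∩ t) ∩ U) * ν ((s ∪ t) ∩ U)) *
          ((if x₀ ∈ s ∩ t then ρ * d ((s ∩ t) ∩ U) else blindOff ent' ρ c d ((s ∩ t) ∩ U)) *
           (ρ * d' ((s ∪ t) ∩ U))) :=
        mul_le_mul hν' hf
          (mul_nonneg (mul_nonneg hρ0 (hd'0 _))
            (liftFactor_nonneg U ent' x₀ ρ c d d hρ0 hρ1 hc0 hd0 hd0 hdc t))
          (mul_nonneg (hν0 _) (hν0 _))
    _ = _ := by ring

omit [LinearOrder R] [IsStrictOrderedRing R] in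
/-- Off `x₀` the lifted gate equals the lifted `R`-law. -/
lemma liftLaw_off (U ent' : Finset V) (x₀ : V) (ρ : R) (ν c d d' : Finset V → R)
    (W' : Finset V) (hW' : W' ∩ {x₀} = ∅) :
    liftLaw U ent' x₀ ρ ν c d d' W' = liftLaw U ent' x₀ ρ ν c d d W' := by
  have hx : x₀ ∉ W' := fun h => by
    have : x₀ ∈ W' ∩ {x₀} := Finset.mem_inter.2 ⟨h, Finset.mem_singleton_self _⟩
    rw [hW'] at this
    exact Finset.notMem_empty _ this
  unfold liftLaw
  rw [if_neg hx, if_neg hx]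

end ChainBlind

end Summit.Ventures.PercRepro2.Coin
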